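import Mathlib.Tactic.Linarith
import Mathlib.Tactic.Ring
import Mathlib.Tactic.NormNum
import Mathlib.Algebra.Order.BigOperators.Group.Finset
import Mathlib.Data.Fintype.BigOperators
import HarnessLib

/-!
# The (0,1) cell of the ι-window, EXISTENCE side, XXV: the theta-dual of the nodal carrier IS the Prym–Brill–Noether curve —
skeleton of `H2-EXISTENCE-SIDE-25.md` (prover 3 gen 32)

Family `hodge`, b2b cell `hweil`, `Summits/HodgeConjecture/HodgeConjecture/Theorems` (helper of item stmt-HodgeConjecture-2524). New topic, new file.

Setting and notation as in [XVI]–[XXIV]: `(A, Θ)` a general ppav fourfold (`NS = ℤθ`, `Θ` smooth, symmetric; not a Jacobian), `γ = θ³/6`,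
`S_a = Θ_a ∩ Θ_{−a}`; `A ≅ P(C̃/C)` the Prym of a double cover `π : C̃ → C` of a genus-4 curve ramified at `a, b ↦ p_a, p_b` (`g(C̃) = 8`),
nodal Abel–Prym carrier `Z_n = ψ(C̃)`, `ψ(x) = x − σx`, theta-dual `Z* = T_{Z_n} = {x : Z_n ⊂ Θ_x}`, `X(u,w) = Θ ∩ Θ_u ∩ Θ_{−w}`.
The report proves: (T) the theta divisor of the two-branch-point Prym is `{L : Nm L = K_C(p_b), h⁰(L) ≥ 1}` (a translate of `Θ`, with
`W_{2g−1}(C̃) · Nm⁻¹(K_C(p_b)) = 2·Ξ_b`; Fay 1973 Ch. V for the analytic form); (Z) `Z*` is a translate of the Prym–Brill–Noether curve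
`{M : Nm M = K_C, h⁰(M) ≥ 2}` (Mumford's trick), hence (Z1) `Z*` has a positive-dimensional component for EVERY presentation (Bud 2024/26,
Thm 4.2 at the generic point + semicontinuity), so [XXIV]'s THEOREM FH⁼ (`kdim = 2`) is unconditional; (NB⁺) the CYCLE-level nodal
Beauville–Debarre identity `Θ·Θ_u·Θ_{−w} = Z* + R`, `Θ·Z* = 8`, `Θ·R = 16`, both irreducible of multiplicity one, `R` the image of the
16-sheeted polygonal curve of the pencil `|K_C − p̄ − q̄|` (genus 21), and `g(Z*) = 9` (Prym–Petri normal bundle).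
HONEST FRAMING: this file records the COMBINATORIAL and ARITHMETIC steps that are genuinely finite (the degree-decomposition lemma that
forces all multiplicities to be one; the multiplicity-two count behind (T); the lift-of-a-base-point syllogism; the Mumford-trick syllogism;
the Riemann–Hurwitz / symmetric-product / Riemann–Roch / Grothendieck–Riemann–Roch bookkeeping). The geometry (Pryms, theta divisors,
Brill–Noether loci, Petri maps, semicontinuity) is NOT kernel-checked; census results about one cell of the ladder's H2 test on the existence
side; no case of the Hodge conjecture is proved; nothing here is a rung; no statement of [Markman 2025] is used. 0 unconditional rungs above
the floor.
-/

set_option linter.dupNamespace false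

namespace Summit.HodgeConjecture.HodgeConjecture.WeilTypeLadder

section H2PrymBrillNoetherXXV

open Finset

/-- RIEMANN–HURWITZ / RIEMANN–ROCH BOOKKEEPING of the two-branch-point Prym (report §2.0): base genus `g = 4`, two branch points, so
`2ĝ − 2 = 2(2g − 2) + 2` gives `ĝ = 8`, `dim P = ĝ − g = 4`, `deg K_{C̃} = 14`; the three models of the Prym torsor used in the report live in
degrees `2g − 2 = 6`, `2g − 1 = 7 = ĝ − 1`, `2g = 8`, with Riemann–Roch differences `h⁰ − h¹ = d + 1 − ĝ = −1, 0, 1`; `h⁰(K_C(p_b)) = g`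
(so `p_b` is a base point of `|K_C(p_b)|`); `2^{2g} = 256` symmetric theta divisors / theta-characteristics of `C`. -/
theorem two_branch_point_prym_bookkeeping (g gh : ℕ) (hg : g = 4) (hRH : 2 * gh - 2 = 2 * (2 * g - 2) + 2) (hgh : 1 ≤ gh) :
    gh = 8 ∧ gh - g = 4 ∧ 2 * gh - 2 = 14 ∧ 2 * g - 2 = 6 ∧ 2 * g - 1 = gh - 1 ∧ 2 * g = 8 ∧
    ((6 : ℤ) + 1 - 8 = -1 ∧ (7 : ℤ) + 1 - 8 = 0 ∧ (8 : ℤ) + 1 - 8 = 1) ∧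
    ((2 * g - 1) + 1 - g = g) ∧ 2 ^ (2 * g) = 256 := by
  subst hg
  have h8 : gh = 8 := by omega
  subst h8
  norm_num

/-- LIFT OF A BASE POINT (report 2.3 (b)): if `π ∘ D` always contains `p_b` and `b` is the ONLY point over `p_b`, then every divisor `D`
contains `b`. Set-theoretic form: `p_b ∈ π(D)` and `π⁻¹(p_b) = {b}` imply `b ∈ D`. -/
theorem base_point_lifts {α β : Type*} (π : α → β) (D : Set α) (pb : β) (b : α)
    (hfib : ∀ x, π x = pb → x = b) (hmem : pb ∈ π '' D) : b ∈ D := by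
  obtain ⟨x, hx, hπ⟩ := hmem
  exact hfib x hπ ▸ hx

/-- THE MULTIPLICITY-TWO COUNT behind THEOREM T (report 2.4): on a ppav with `NS = ℤθ`, the divisor `W|_{P_b}` has class `2ξ` and splits as
`Σ m_j Ξ_j` with every multiplicity `m_j ≥ 2` (tangency along each component) and every component class `d_j ξ`, `d_j ≥ 1`; then
`Σ m_j d_j = 2` forces ONE component, `m = 2`, `d = 1`: `W · P_b = 2Ξ_b` with `Ξ_b` a theta divisor. -/
theorem theta_multiplicity_two {ι : Type*} [Fintype ι] [Nonempty ι] (m d : ι → ℕ)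
    (hm : ∀ i, 2 ≤ m i) (hd : ∀ i, 1 ≤ d i) (h : ∑ i, m i * d i = 2) :
    Fintype.card ι = 1 ∧ ∀ i, m i = 2 ∧ d i = 1 := by
  have h1 : ∀ i, 2 ≤ m i * d i := fun i => by
    have := Nat.mul_le_mul (hm i) (hd i)
    simpa using this
  have h2 : Fintype.card ι * 2 ≤ ∑ i, m i * d i := by
    have := Finset.card_nsmul_le_sum (Finset.univ : Finset ι) (fun i => m i * d i) 2 (fun i _ => h1 i)
    simpa using this
  have hpos : 0 < Fintype.card ι := Fintype.card_pos
  have hcard : Fintype.card ι = 1 := by omega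
  refine ⟨hcard, fun i => ?_⟩
  have h3 : m i * d i ≤ ∑ j, m j * d j :=
    Finset.single_le_sum (f := fun j => m j * d j) (fun j _ => Nat.zero_le _) (Finset.mem_univ i)
  have h4 : m i * d i = 2 := by have := h1 i; omega
  have h5 : d i ≤ 1 := by
    by_contra hc
    push Not at hc
    have : 4 ≤ m i * d i := by
      have := Nat.mul_le_mul (hm i) hc
      simpa using this
    omega
  have h6 : d i = 1 := le_antisymm h5 (hd i)
  refine ⟨?_, h6⟩
  rw [h6, Nat.mul_one] at h4
  exact h4

/-- MUMFORD'S TRICK, the syllogism (report 3.1): for the theta-dual condition `T(L)` = '`L(x − σx)` is effective for every `x`' and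
`h = h⁰(L)`: (i) `x` = a ramification point gives `T → h ≥ 1`; (ii) `h ≥ 2 → T` (drop one point); (iii) `h = 1 → ¬T` (the unique divisor
misses a general `σx`). Hence `T ↔ h ≥ 2`: the theta-dual is the locus `{h⁰ ≥ 2}`. -/
theorem mumford_trick_syllogism (h : ℕ) (T : Prop) (hi : T → 1 ≤ h) (hii : 2 ≤ h → T) (hiii : h = 1 → ¬T) :
    T ↔ 2 ≤ h := by
  constructor
  · intro hT
    have h1 := hi hT
    by_contra hc
    exact hiii (by omega) hT
  · exact hii

/-- THE RAN-TYPE DEGREE BOUND, skeleton (report 4.2 LEMMA MR): for a curve `Γ` generating the simple fourfold `A` (`n = 4`) the translates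
`Θ_x ∩ Γ` give an `n`-dimensional family inside `W_d(Γ̃)` of dimension `w ≤ d`, so `d ≥ n = 4`; `d = 4` would make `(A, Θ)` a Jacobian
(Matsusaka–Ran), excluded by (G3); hence every curve in `A` has `Θ`-degree `≥ 5`. -/
theorem curve_degree_at_least_five (n d w : ℕ) (hn : n = 4) (hw : n ≤ w) (hwd : w ≤ d) (hJ : d ≠ n) : 5 ≤ d := by
  omega

/-- THE DEGREE-DECOMPOSITION LEMMA (report 4.3, LOAD-BEARING for THEOREM NB⁺): the complete-intersection curve `X = Θ·Θ_u·Θ_{−w}` has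
`Θ`-degree `θ⁴ = 24`; it contains the (non-empty, 1-dimensional part of the) theta-dual `Z*` with components of degrees `d_i` and
multiplicities `m_i`, the components `S_j` of the image of the polygonal curve, of multiplicities `n_j` and degrees `e_j` with `Σ e_j = 16`,
and possibly further components of total degree `r` (`r = 0` or `r ≥ 5`); every curve in `A` has degree `≥ 5`. CONCLUSION: no further
components, all multiplicities one, and `Z*` is a SINGLE component of degree `8`. -/
theorem cycle_degree_decomposition {ι κ : Type*} [Fintype ι] [Nonempty ι] [Fintype κ] [DecidableEq κ]
    (m d : ι → ℕ) (n e : κ → ℕ) (r : ℕ)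
    (hm : ∀ i, 1 ≤ m i) (hd : ∀ i, 5 ≤ d i) (hn : ∀ j, 1 ≤ n j) (he : ∀ j, 5 ≤ e j)
    (hr : r = 0 ∨ 5 ≤ r) (hse : ∑ j, e j = 16)
    (htot : ∑ i, m i * d i + ∑ j, n j * e j + r = 24) :
    r = 0 ∧ (∀ j, n j = 1) ∧ Fintype.card ι = 1 ∧ ∀ i, m i = 1 ∧ d i = 8 := by
  -- (1) the Z*-part has degree ≥ 5
  have hZ1 : ∀ i, 5 ≤ m i * d i := fun i => by
    have := Nat.mul_le_mul (hm i) (hd i)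
    simpa using this
  have hZ : Fintype.card ι * 5 ≤ ∑ i, m i * d i := by
    have := Finset.card_nsmul_le_sum (Finset.univ : Finset ι) (fun i => m i * d i) 5 (fun i _ => hZ1 i)
    simpa using this
  have hpos : 0 < Fintype.card ι := Fintype.card_pos
  -- (2) the S-part has degree ≥ 16
  have hS : ∑ j, e j ≤ ∑ j, n j * e j :=
    Finset.sum_le_sum (fun j _ => Nat.le_mul_of_pos_left (e j) (hn j))
  -- (3) hence r ≤ 3, so r = 0
  have hr0 : r = 0 := by
    rcases hr with h | h
    · exact h
    · exfalso
      have : 5 ≤ ∑ i, m i * d i := le_trans (by omega) hZ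
      omega
  subst hr0
  -- (4) all n_j = 1: otherwise the S-part has degree ≥ 16 + 5
  have hn1 : ∀ j, n j = 1 := by
    by_contra hc
    push Not at hc
    obtain ⟨j, hj⟩ := hc
    have hj2 : 2 ≤ n j := by have := hn j; omega
    have hS' : ∑ k, (e k + if k = j then e k else 0) ≤ ∑ k, n k * e k := by
      apply Finset.sum_le_sum
      intro k _
      by_cases hk : k = j
      · subst hk
        simp only [if_true]
        have : 2 * e k ≤ n k * e k := Nat.mul_le_mul_right (e k) hj2
        omega
      · simp only [hk, if_false, Nat.add_zero]
        exact Nat.le_mul_of_pos_left (e k) (hn k)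
    have hsplit : ∑ k, (e k + if k = j then e k else 0) = (∑ k, e k) + e j := by
      rw [Finset.sum_add_distrib, Finset.sum_ite_eq' Finset.univ j (fun k => e k)]
      simp
    have : 5 ≤ ∑ i, m i * d i := le_trans (by omega) hZ
    have hej := he j
    omega
  -- (5) so the S-part has degree exactly 16 and the Z*-part exactly 8
  have hS16 : ∑ j, n j * e j = 16 := by
    have : ∑ j, n j * e j = ∑ j, e j := Finset.sum_congr rfl (fun j _ => by rw [hn1 j, Nat.one_mul])
    omega
  have hZ8 : ∑ i, m i * d i = 8 := by omega
  -- (6) one component of degree 8, multiplicity 1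
  have hcard : Fintype.card ι = 1 := by omega
  refine ⟨rfl, hn1, hcard, fun i => ?_⟩
  have hall : ∀ a b : ι, a = b := Fintype.card_le_one_iff.mp (le_of_eq hcard)
  have hsingle : ∑ k, m k * d k = m i * d i := by
    apply Finset.sum_eq_single i
    · intro b _ hb
      exact absurd (hall b i) hb
    · intro hi
      exact absurd (Finset.mem_univ i) hi
  have h8 : m i * d i = 8 := by omega
  have hdi : d i ≤ 8 := by
    have := Nat.le_mul_of_pos_left (d i) (hm i)
    omega
  have hd5 := hd i
  have hm1 : m i ≤ 1 := by
    by_contra hc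
    push Not at hc
    have : 2 * d i ≤ m i * d i := Nat.mul_le_mul_right (d i) hc
    omega
  have hmi : m i = 1 := le_antisymm hm1 (hm i)
  refine ⟨hmi, ?_⟩
  rw [hmi, Nat.one_mul] at h8
  exact h8

/-- THE POLYGONAL CURVE OF THE PENCIL `|K_C − p̄ − q̄|` (report 4.1): a base-point-free `g¹₄` on `C` (genus 4) has `2·4 + 2·4 − 2 = 14`
critical points; its curve of lifts `B ⊂ C̃₄` has `2⁴ = 16` sheets over `ℙ¹`, meets the incidence divisor `x` in `2³ = 8` points and the
diagonal in `8 · 14 = 112`, so by `θ̂|_{C̃₄} ≡ (ĝ + d − 1)x − Δ/2` (ACGH VIII §5) its `θ̂`-degree is `11·8 − 56 = 32 = 2·16`: `Θ`-degree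
`16` in the Prym (`θ̂|_P ≡ 2ξ`); its arithmetic genus from `K_{C̃₄} ≡ θ̂ + (ĝ − d − 1)x` and `deg N_{ℓ/C₄} = −1`: `2p_a − 2 = (32 + 3·8)
− 16 = 40`, `p_a = 21`; the same number by Riemann–Hurwitz with `14·4 + 2·8 = 72` simple ramification points. -/
theorem polygonal_curve_counts :
    (2 ^ 4 = 16) ∧ (2 ^ 3 = 8) ∧ (2 * 4 + 2 * 4 - 2 = 14) ∧ (8 * 14 = 112) ∧
    ((8 + 4 - 1) * 8 - 112 / 2 = 32) ∧ (32 = 2 * 16) ∧ (14 * 4 + 2 * 8 = 72) ∧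
    ((2 : ℤ) * 21 - 2 = 16 * (2 * 0 - 2) + 72) ∧ ((2 : ℤ) * 21 - 2 = (32 + (8 - 4 - 1) * 8) + 16 * (-1)) := by
  norm_num

/-- THE ARITHMETIC-GENUS BUDGET (report 4.5): `X = Z* ∪ R` reduced complete intersection with `ω_X = 𝒪_X(3Θ)`, `2p_a(X) − 2 = 3·24`, so
`p_a(X) = 37`; `p_a(X) + 1 = p_a(Z*) + p_a(R) + length(Z* ∩ R)`; with `p_a(Z*) = 9` (Prym–Petri, THEOREM G9) and `p_a(R) = 21`
(`R ≅` the smooth genus-21 polygonal curve: the map is an injective immersion), the length is `8`; since it is bounded by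
`lmax = length(Z* ∩ Θ_{u−w}) ≤ Θ·Z* = 8` (as `R ⊂ Θ_{u−w}`), the bound is attained: every point of `Z* ∩ Θ_{u−w}` lies on `R` with
full multiplicity — no residual points in `S_a ∩ S_{a′}`. -/
theorem arithmetic_genus_budget (p pZ pR l lmax : ℕ) (hp : 2 * p = 3 * 24 + 2) (hsplit : p + 1 = pZ + pR + l)
    (hZ : pZ = 9) (hR : pR = 21) (hl : l ≤ lmax) (hlmax : lmax ≤ 8) : p = 37 ∧ l = 8 ∧ lmax = l := by
  omega

/-- THE PRYM–PETRI NORMAL-BUNDLE COMPUTATION (report 3.4, THEOREM G9): on the smooth Prym–Brill–Noether curve `V = V¹(f)` with universal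
bundle `𝓜` of fibre degree `dV` along `V`: `A = π_*𝓜` (rank 2), `B = π_*(ω ⊠ 𝓜⁻¹)` (rank 3), twist class `n = deg 𝓝 = 2·dV`;
Grothendieck–Riemann–Roch gives `deg A + deg B = −θ̂·V − dV = −16 − dV`; the evaluation sequence `0 → A ⊗ 𝓝⁻¹ → B → 𝓜⁻¹|_{V×a} → 0` gives
`deg B = (deg A − 2n) − dV`; the conormal bundle is `(A ⊗ B)/(S²A ⊗ 𝓝⁻¹)`, so `2 − 2g(V) = 2·deg B + 3n`. CONCLUSION: `g(V) = 9`,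
independently of the normalisation `dV`. -/
theorem prym_petri_genus (a b n dV g : ℤ) (hN : n = 2 * dV) (hGRR : a + b = -16 - dV) (hQ : b = (a - 2 * n) - dV)
    (hconormal : 2 - 2 * g = 2 * b + 3 * n) : g = 9 := by
  subst hN
  omega

/-- SEMICONTINUITY STEP for (Z1) (report 3.3): on the irreducible base `ℛ_{4,2}` the fibre dimension of the proper family of
Prym–Brill–Noether loci is upper semicontinuous; it is `1` at the generic point (Bud), so it is `≥ 1` everywhere. Skeleton: an upper
semicontinuous `ℕ`-valued function on a space whose every non-empty open set meets a set where the value is `≥ 1` is `≥ 1` everywhere —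
stated for the order-theoretic core: if `U = {x : f x < 1}` is open and disjoint from a dense set `D` (on which `f ≥ 1`), and every non-empty
open set meets `D`, then `U = ∅`. -/
theorem semicontinuity_step {X : Type*} (f : X → ℕ) (IsOpen' : Set X → Prop) (D : Set X)
    (hdense : ∀ U : Set X, IsOpen' U → U.Nonempty → (U ∩ D).Nonempty)
    (hD : ∀ x ∈ D, 1 ≤ f x) (hU : IsOpen' {x | f x < 1}) : ∀ x, 1 ≤ f x := by
  intro x
  by_contra hc
  push Not at hc
  obtain ⟨y, hyU, hyD⟩ := hdense {x | f x < 1} hU ⟨x, hc⟩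
  have := hD y hyD
  exact absurd this (by simpa using hyU)

end H2PrymBrillNoetherXXV

end Summit.HodgeConjecture.HodgeConjecture.WeilTypeLadder
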